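/- Copyright: the b2b-balaban cell (near-miss cell 7), T⁴-continuum fan-out; row NE7b CRUX team (2), the row OWNER
`t4-ne7b-p1` (gen 49) — RULING R-OWNER-49-1 (d) «NEEDS-CONSTANT FIBRE-1, the WEIGHTED count» ((α)-M5-5b, row S25 (b);
sibling of `HistoryBankingFibreResum` p288991, kept apart by the 400-line cap).  Released under the licence of the
surrounding project. -/
import Summits.QuantumFields.BalabanUV.T4Continuum.Support.HistoryBankingFibreResum

/-!
# (α)-M5-5b «RESUMMED BY WEIGHT, NOT COUNTED»: the per-member decoration mass of the fibre resummation lemma when the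
# decorations carry their own small factors

Summits-side support leaf of the T⁴-continuum cell (rung (B)+1 on a FINITE torus only; NOT infinite volume, NOT the
mass gap, NOT the Clay statement; NOT a proof of the spine estimate NE7b — the cell's OWN estimate, NOT PRINTED, NOT
PROVED).  [folklore] finite combinatorics + real arithmetic over the sibling's letters (`ncount`, `nsum`,
`fibreMass_of_decoration`'s hypothesis `hmass`); no `structure`, no `[cite:]` tag, nothing printed asserted, no `Prop`
fact minted, zero `sorry`.  B16 = [Balaban1989LargeFieldII] is a manuscript UNDER AUDIT; p. 383 («the summations over
the admissible sequences can be replaced by the factors exp O(1)(MR_j)^{−d}|Z_j|») and p. 389 (1.96) are LOCATORS only.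

WHY.  The sibling M5-5 reduces the display (ρ) `FibreMass` to (ρ1) an injective decoration of the key fibre, (ρ2) a
factorised weight and (ρ3) the per-member mass `Σ_{x ∈ Dec w} u w x ≤ exp (nsum φ w.2.1)`, and proves (ρ3) for the
CRUDE count (`u ≡ 1`, `2^{bits}` choices per event: `ncount_le_exp_nsum`, `two_pow_le_exp`).  RULING R-OWNER-49-1 (d)
asks the refuter ∕ balaban-calc (NEEDS-CONSTANT «FIBRE-1») to price TWO currencies for the share `φ = sharpT (φB K)
(φR K)`: (i) the crude one and (ii) the WEIGHTED one — R-OWNER-48-2's «the key fibre is resummed by weight, not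
counted»: when an event flags a NONEMPTY set `S` of the member's `n` cubes and every flagged cube beyond the first carries
its own small factor `ε` (the first one being booked in the live price), the decorations weigh `ε^{|S|−1}` and their
mass is `Σ_{S ≠ ∅} ε^{|S|−1} ≤ n·(1+ε)^{n−1} ≤ exp (log n + (n−1)·ε)` — LOGARITHMIC in the cube count instead of
linear.  This file puts (ii)'s binomial lemma and the weighted node mass in the kernel, so that whichever currency the
room affords, (ρ3) is a theorem the day the share letters are fixed.

WHAT.  §1 `sum_image_insert_pow_card_sub_one` (the binomial identity behind the induction),
**`sum_powerset_nonempty_pow_le`** (`Σ_{S ⊆ s, S ≠ ∅} ε^{|S|−1} ≤ |s|·(1+ε)^{|s|−1}`, `ε ≥ 0`),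
`natCast_mul_pow_le_exp` (`n·(1+ε)^{n−1} ≤ exp (log n + (n−1)ε)`), **`sum_flags_le_exp`** (the weighted flag mass is
within its share as soon as `log n + (n−1)ε ≤ φ`).  §2 **`nmass M : Gen ε → ℝ`** (product over the NODES of a
real per-event mass, `nsum`'s recursion; `ncount`'s real twin), `nmass_nonneg`, **`nmass_le_exp_nsum`**
(`0 ≤ M e ≤ exp (φ e)` ⇒ `nmass M G ≤ exp (nsum φ G)`), `ncount_cast_eq_nmass`.  §3 the junction with the sibling's
`hmass`: **`mass_le_exp_nsum_of_le_nmass`** (a member's decoration mass bounded by `nmass M w.2.1` is bounded by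
`exp (nsum φ w.2.1)`), and the weighted per-event currency as a named share condition `weighted_event_le_exp` (`n(1+ε)^{n−1} ≤ exp φ` from
`log n + (n−1)ε ≤ φ`; the crude currency is the sibling's `two_pow_le_exp`).
§4 decided toys (`n = 3`, `ε = 1`: `7 ≤ 12`; a two-event genealogy).

HONEST SCOPE.  Bookkeeping.  Which currency is the model's is a READING question: as typed, M2-B's `HistFactors.fR K h`
books ONE renewal factor per renewed part (the extra per-flagged-cube factors of print's (1.79)∕(1.96) are discarded by
`HistRead.forest_le`'s one-sided reading), so the crude currency (i) is what `HistReadDataL` can use today; the weighted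
currency (ii) needs a finer reading that keeps the extra factors in `u`.  Both are affordable by orders of magnitude at
the window of record (share `∝ (d′+1)·dictW` vs credit `½γ₀A₁²p₀(g)²(d′+1)`, `p₀(g) = A₀ℓ^{p₀}`) — a census sentence,
certified by the refuter ∕ balaban-calc, not here.  BY-NAME EFFECT ON THE WALL: NONE by itself ((ρ) stays the field `hρ`
until IR-49-1 instantiates (ρ0)(ρ1)(ρ2) on `HistReading`'s carriers).  NE7b NOT PRINTED ∕ NOT PROVED; spine 0∕9.
HONEST DEPENDENCY (cell): continuum YM on T⁴ ⇐ BetaPertH ∧ nine spine estimates (0/9 proved); BetaPertH ⇐ (D1) ∧ (D4)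
∧ CAP+tail; G-an2-4 gates asym, D1 and NE2/3/4.  This file changes none of it.
-/

open Finset
open Literature.MathematicalPhysics.QuantumFieldTheory.Balaban1983to89
open T4PersistenceDictionary
open Summit.QuantumFields.BalabanUV.T4Continuum.HistoryPriceNodeSum
open Summit.QuantumFields.BalabanUV.T4Continuum.HistoryBankingFibreResum

namespace Summit.QuantumFields.BalabanUV.T4Continuum.HistoryBankingFibreResumWeighted

noncomputable section

/-! ## §1 The weighted flag mass: `Σ_{S ≠ ∅} ε^{|S|−1} ≤ n·(1+ε)^{n−1}` -/

section Flags

variable {α : Type*} [DecidableEq α]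

/-- the `insert a`-images of the sub-unions of `s` (`a ∉ s`) weigh `Σ ε^{|S|−1} = (1+ε)^{|s|}` (binomial theorem,
`Finset.sum_pow_mul_eq_add_pow`). [folklore] -/
theorem sum_image_insert_pow_card_sub_one (s : Finset α) {a : α} (ha : a ∉ s) (ε : ℝ) :
    ∑ S ∈ (s.powerset).image (insert a), ε ^ (S.card - 1) = (1 + ε) ^ s.card := by
  have hinj : Set.InjOn (insert a) (↑(s.powerset) : Set (Finset α)) := by
    intro S hS S' hS' h
    have haS : a ∉ S := fun h' => ha (Finset.mem_powerset.1 (Finset.mem_coe.1 hS) h')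
    have haS' : a ∉ S' := fun h' => ha (Finset.mem_powerset.1 (Finset.mem_coe.1 hS') h')
    have := congrArg (fun T => Finset.erase T a) h
    simpa [Finset.erase_insert haS, Finset.erase_insert haS'] using this
  rw [Finset.sum_image hinj]
  have h1 : ∀ S ∈ s.powerset, ε ^ ((insert a S).card - 1) = ε ^ S.card * 1 ^ (s.card - S.card) := by
    intro S hS
    have haS : a ∉ S := fun h' => ha (Finset.mem_powerset.1 hS h')
    rw [Finset.card_insert_of_notMem haS, one_pow, mul_one]
    rfl
  rw [Finset.sum_congr rfl h1, Finset.sum_pow_mul_eq_add_pow, add_comm]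

/-- **RESUMMED BY WEIGHT, NOT COUNTED**: the nonempty sub-unions `S` of an `n`-cube set, each weighted by
`ε^{|S|−1}` (one small factor per flagged cube beyond the first — the first is booked in the live price), sum to at
most `n·(1+ε)^{n−1}` (induction on the cube set; exact for `ε = 0`: `n` singletons). [folklore] -/
theorem sum_powerset_nonempty_pow_le (s : Finset α) {ε : ℝ} (hε : 0 ≤ ε) :
    ∑ S ∈ s.powerset with S.Nonempty, ε ^ (S.card - 1) ≤ s.card * (1 + ε) ^ (s.card - 1) := by
  induction s using Finset.induction_on with
  | empty => simp [Finset.filter_singleton]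
  | @insert a s ha ih =>
    rw [Finset.powerset_insert, Finset.filter_union]
    have hdisj : Disjoint (s.powerset.filter fun S => S.Nonempty)
        ((s.powerset.image (insert a)).filter fun S => S.Nonempty) := by
      rw [Finset.disjoint_left]
      intro S hS hS'
      have h1 : a ∉ S := fun h' => ha (Finset.mem_powerset.1 (Finset.mem_filter.1 hS).1 h')
      obtain ⟨S', -, rfl⟩ := Finset.mem_image.1 (Finset.mem_filter.1 hS').1
      exact h1 (Finset.mem_insert_self a S')
    rw [Finset.sum_union hdisj]
    have h2 : (s.powerset.image (insert a)).filter (fun S => S.Nonempty) = s.powerset.image (insert a) := by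
      refine Finset.filter_true_of_mem fun S hS => ?_
      obtain ⟨S', -, rfl⟩ := Finset.mem_image.1 hS
      exact Finset.insert_nonempty a S'
    rw [h2, sum_image_insert_pow_card_sub_one s ha ε, Finset.card_insert_of_notMem ha, Nat.add_sub_cancel]
    have h1ε : 1 ≤ 1 + ε := by linarith
    have hpow : (1 + ε) ^ (s.card - 1) ≤ (1 + ε) ^ s.card := pow_le_pow_right₀ h1ε (Nat.sub_le _ _)
    have hn : (0 : ℝ) ≤ s.card := Nat.cast_nonneg _
    calc ∑ S ∈ s.powerset with S.Nonempty, ε ^ (S.card - 1) + (1 + ε) ^ s.card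
        ≤ s.card * (1 + ε) ^ (s.card - 1) + (1 + ε) ^ s.card := by linarith [ih]
      _ ≤ s.card * (1 + ε) ^ s.card + (1 + ε) ^ s.card := by nlinarith [hpow, hn]
      _ = ((s.card + 1 : ℕ) : ℝ) * (1 + ε) ^ s.card := by push_cast; ring

omit [DecidableEq α] in
/-- `n·(1+ε)^{n−1} ≤ exp (log n + (n−1)·ε)` (`1 + ε ≤ e^ε`). [folklore] -/
theorem natCast_mul_pow_le_exp (n : ℕ) {ε : ℝ} (hε : 0 ≤ ε) :
    (n : ℝ) * (1 + ε) ^ (n - 1) ≤ Real.exp (Real.log n + ((n - 1 : ℕ) : ℝ) * ε) := by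
  rcases Nat.eq_zero_or_pos n with rfl | hn
  · simp
  have hn' : (0 : ℝ) < n := by exact_mod_cast hn
  rw [Real.exp_add, Real.exp_log hn', Real.exp_nat_mul]
  refine mul_le_mul_of_nonneg_left ?_ hn'.le
  exact pow_le_pow_left₀ (by linarith) (by linarith [Real.add_one_le_exp ε]) _

/-- **THE WEIGHTED FLAG MASS IS WITHIN ITS SHARE** as soon as `log n + (n−1)·ε ≤ φ` (`n = #cubes`). [folklore] -/
theorem sum_flags_le_exp (s : Finset α) {ε φ : ℝ} (hε : 0 ≤ ε)
    (h : Real.log s.card + ((s.card - 1 : ℕ) : ℝ) * ε ≤ φ) :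
    ∑ S ∈ s.powerset with S.Nonempty, ε ^ (S.card - 1) ≤ Real.exp φ :=
  (sum_powerset_nonempty_pow_le s hε).trans ((natCast_mul_pow_le_exp s.card hε).trans (Real.exp_le_exp.2 h))

end Flags

/-! ## §2 The weighted node mass of a genealogy -/

section NodeMass

variable {ε : Type*}

/-- **THE NODE MASS OF A GENEALOGY**: the product over the NODES of a real per-event mass `M e` (e.g. the weighted flag
mass `n(1+ε)^{n−1}` of a renewal, `1` at a merger) — `nsum`'s recursion, the real twin of the sibling's `ncount`.
[folklore] -/
def nmass (M : ε → ℝ) : Gen ε → ℝ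
  | Gen.born b _ => M b
  | Gen.renew G e _ => nmass M G * M e
  | Gen.merge X Y e => nmass M X * nmass M Y * M e

/-- node mass of a bare birth [folklore] -/
@[simp] theorem nmass_born (M : ε → ℝ) (b : ε) (j : ℕ) : nmass M (Gen.born b j) = M b := rfl
/-- node mass after a renewal [folklore] -/
@[simp] theorem nmass_renew (M : ε → ℝ) (G : Gen ε) (e : ε) (h : ℕ) :
    nmass M (Gen.renew G e h) = nmass M G * M e := rfl
/-- node mass after a merger [folklore] -/
@[simp] theorem nmass_merge (M : ε → ℝ) (X Y : Gen ε) (e : ε) :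
    nmass M (Gen.merge X Y e) = nmass M X * nmass M Y * M e := rfl

/-- the node mass of nonnegative per-event masses is nonnegative [folklore] -/
theorem nmass_nonneg (M : ε → ℝ) (h : ∀ e, 0 ≤ M e) : ∀ G : Gen ε, 0 ≤ nmass M G
  | Gen.born b _ => by simpa using h b
  | Gen.renew G e _ => by rw [nmass_renew]; exact mul_nonneg (nmass_nonneg M h G) (h e)
  | Gen.merge X Y e => by
    rw [nmass_merge]; exact mul_nonneg (mul_nonneg (nmass_nonneg M h X) (nmass_nonneg M h Y)) (h e)

/-- **THE NODE MASS IS AT MOST `exp` OF THE NODE SUM** when every event's mass is within `exp` of its share: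
`∀ e, 0 ≤ M e ≤ exp (φ e)` ⇒ `nmass M G ≤ exp (nsum φ G)` — print's p. 383 sentence along a genealogy, in the weighted
currency. [folklore] -/
theorem nmass_le_exp_nsum (M : ε → ℝ) (φ : ε → ℝ) (h0 : ∀ e, 0 ≤ M e) (h : ∀ e, M e ≤ Real.exp (φ e)) :
    ∀ G : Gen ε, nmass M G ≤ Real.exp (nsum φ G)
  | Gen.born b _ => by simpa using h b
  | Gen.renew G e _ => by
    rw [nmass_renew, nsum_renew, Real.exp_add]
    exact mul_le_mul (nmass_le_exp_nsum M φ h0 h G) (h e) (h0 e) (Real.exp_nonneg _)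
  | Gen.merge X Y e => by
    rw [nmass_merge, nsum_merge, Real.exp_add, Real.exp_add]
    exact mul_le_mul (mul_le_mul (nmass_le_exp_nsum M φ h0 h X) (nmass_le_exp_nsum M φ h0 h Y)
      (nmass_nonneg M h0 Y) (Real.exp_nonneg _)) (h e) (h0 e) (by positivity)

/-- the sibling's integer node count is the node mass of the cast counts [folklore] -/
theorem ncount_cast_eq_nmass (N : ε → ℕ) : ∀ G : Gen ε, (ncount N G : ℝ) = nmass (fun e => (N e : ℝ)) G
  | Gen.born b _ => by simp
  | Gen.renew G e _ => by rw [ncount_renew, nmass_renew, Nat.cast_mul, ncount_cast_eq_nmass N G]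
  | Gen.merge X Y e => by
    rw [ncount_merge, nmass_merge, Nat.cast_mul, Nat.cast_mul, ncount_cast_eq_nmass N X, ncount_cast_eq_nmass N Y]

end NodeMass

/-! ## §3 The junction with the sibling's per-member hypothesis `hmass`, and the two per-event currencies -/

section Junction

variable {γ δ' δ : Type*}

/-- **A MEMBER's WEIGHTED DECORATION MASS BOUNDED ALONG ITS GENEALOGY**: if the decoration mass of a key member is at
most the node mass `nmass M w.2.1` of per-event masses within their shares, it is at most `exp (nsum φ w.2.1)` — the
hypothesis `hmass` of `fibreMass_of_decoration`, member by member. [folklore] -/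
theorem mass_le_exp_nsum_of_le_nmass (M : PEv → ℝ) (φ : PEv → ℝ) (h0 : ∀ e, 0 ≤ M e)
    (h : ∀ e, M e ≤ Real.exp (φ e)) {w : γ × Gen PEv × δ'} {D : Finset δ} {u : δ → ℝ}
    (hD : ∑ x ∈ D, u x ≤ nmass M w.2.1) : ∑ x ∈ D, u x ≤ Real.exp (nsum φ w.2.1) :=
  hD.trans (nmass_le_exp_nsum M φ h0 h w.2.1)

-- CURRENCY (i), CRUDE, is the sibling's `two_pow_le_exp` (`2^{bits} ≤ exp φ` from `bits·log 2 ≤ φ`): not restated.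

/-- **CURRENCY (ii), WEIGHTED**: an event flagging a nonempty subset of `n` cubes with a small factor `ε` per flagged cube
beyond the first has mass `≤ n(1+ε)^{n−1}`, within its share as soon as `log n + (n−1)ε ≤ φ`. [folklore] -/
theorem weighted_event_le_exp {n : ℕ} {ε φ : ℝ} (hε : 0 ≤ ε) (h : Real.log n + ((n - 1 : ℕ) : ℝ) * ε ≤ φ) :
    (n : ℝ) * (1 + ε) ^ (n - 1) ≤ Real.exp φ :=
  (natCast_mul_pow_le_exp n hε).trans (Real.exp_le_exp.2 h)

/-- the weighted per-event mass is nonnegative [folklore] -/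
theorem weighted_event_nonneg (n : ℕ) {ε : ℝ} (hε : 0 ≤ ε) : 0 ≤ (n : ℝ) * (1 + ε) ^ (n - 1) := by positivity

end Junction

/-! ## §4 Decided toys -/

section Toy

/-- three cubes, `ε = 1`: the seven nonempty sub-unions weigh `7 ≤ 3·2² = 12`. [folklore] -/
theorem toy_flags : ∑ S ∈ (Finset.range 3).powerset with S.Nonempty, (1 : ℝ) ^ (S.card - 1) ≤ 3 * (1 + 1) ^ (3 - 1) := by
  have h := sum_powerset_nonempty_pow_le (Finset.range 3) (ε := (1 : ℝ)) zero_le_one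
  simpa using h

/-- the node mass of a two-event toy genealogy (`born` with mass `3`, then `renew` with mass `2`) is `6`. [folklore] -/
theorem toy_nmass : nmass (fun e : PEv => if e.kind = 0 then (3 : ℝ) else 2)
    (Gen.renew (Gen.born ((0, 0, 1) : PEv) 0) ((1, 1, 0) : PEv) 0) = 6 := by
  simp [nmass, PEv.kind]
  norm_num

end Toy

end

end Summit.QuantumFields.BalabanUV.T4Continuum.HistoryBankingFibreResumWeighted
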